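import Summits.NavierStokesRegularity.FunctionalMining.HsChessboardHigh
import Literature.Analysis.FunctionSpaces.TorusSupNormContinuity
import HarnessLib

/-!
# FunctionalMining — the row `m = ∞` of Gibbon's chessboard on `T³` in sup-norm form:
# `∫₀ᵀ ‖∇ⁿu(t)‖_∞^{1/(n+1)} dt ≤ K(1+T)` for every `n ≥ 0`

Search for candidate a priori estimates; no regularity claim. Cell `pub-nsfunc`, lit seat (gen 16);
CRITERIA §B row B4. `HsChessboardHigh` proves the row `m = ∞` of Gibbon's chessboard
(J. Nonlinear Sci. 29 (2019) 215–228, Thm 2 (i) `n ≥ 1, 1 ≤ m ≤ ∞`, (ii) `n = 0, 3 < m ≤ ∞`, eq. (w1)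
— the norm form; Thm 1 (i)–(ii) is the same bound in inverse-length-scale form;
`α_{n,∞} = 1/(n+1)`) in MAJORANT form: the Agmon majorant
`A_n(t) = (2/π²) √E_{n+1}(u(t)) √E_{n+2}(u(t)) ≥ |∇ⁿu(t,x)|²` has `∫₀ᵀ A_n^{1/(2(n+1))} ≤ K(1+T)`.
Here the same square is stated with the genuine sup norm `‖ |∇ⁿu(t)|² ‖_{L^∞} = ⨆ₓ |∇ⁿu(t,x)|²`
(`eSupNorm`, `Literature/Analysis/FunctionSpaces/HolderNorm`), `|∇ⁿu|² = ∑_{|w|=n} ‖∂^w u‖²`: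

* `HsChessboard.isSmoothSpaceTimeOn_wordSq`, `continuousOn_supWordSq` — `|∇ⁿu|²` is jointly
  smooth on `[a, b] × T^d` along a classical solution, so `t ↦ ‖ |∇ⁿu(t)|² ‖_∞` is continuous
  (tube lemma, `Torus.IsSmoothSpaceTimeOn.continuousOn_toReal_eSupNorm`) — the time integrals
  below are integrals of continuous functions, not integrals by convention;
* `HsChessboard.supWordSq_le_agmonMajorant` — `‖ |∇ⁿv|² ‖_∞ ≤ (2/π²) √E_{n+1}(v) √E_{n+2}(v)`
  for smooth zero-mean `v` on `T³` (Agmon at every order);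
* `HsChessboard.chessboard_sup` — **row `m = ∞`, every `n ≥ 0`**: for `ν > 0`, `M ≥ 0` there is
  `K ≥ 0` with `∫₀ᵀ ‖ |∇ⁿu(t)|² ‖_∞^{1/(2(n+1))} dt ≤ K(1+T)`, i.e.
  `∫₀ᵀ ‖∇ⁿu‖_∞^{α_{n,∞}} ≤ K(1+T)`, along every classical zero-mean solution of unforced
  Navier–Stokes on `[0, T] × T³` with `‖u(0)‖₂² ≤ M`;
* `HsChessboard.chessboard_sup_one` — the square `(1, ∞)` (the Beale–Kato–Majda-level quantity of
  Gibbon's Table 1, halved exponent): `∫₀ᵀ ‖ |∇u(t)|² ‖_∞^{1/4} dt ≤ K(1+T)`,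
  `|∇u|² = ∑ᵢ ‖∂ᵢu‖²`, i.e. `∫₀ᵀ ‖∇u‖_∞^{1/2} ≤ K(1+T)`.

The square `(0, ∞)` — `u ∈ L¹(0,T;L^∞)`, Foias–Guillopé–Temam 1981 / Robinson–Rodrigo–Sadowski
Lemma 8.15 (8.7) — is already in the tree with explicit constants
(`Literature.Analysis.FluidPDE.integral_toReal_eSupNorm_le`); `chessboard_sup 0` is the same
square in the chessboard's shape. Faithfulness: classical instead of Leray–Hopf solutions, `f = 0`,
constants existential. Energy-class a priori bounds; they assert neither regularity nor blow-up.

## References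

* [Gibbon2019Chessboard] J. D. Gibbon, J. Nonlinear Sci. 29 (2019) 215–228, Thm 2 (i)–(ii) eq. (w1)
  with `m = ∞` (norm form; Thm 1 (i)–(ii) / Table 1 row `m = ∞` is the inverse-length-scale form),
  Appendix A (held: arXiv:1803.11518 pp. 4–7; Thm 1 p. 4 L49–53, Thm 2 p. 5 L7–9).
* [FoiasGuillopeTemam1981] Comm. PDE 6 (1981) 329–359, Thm 3.1; `L¹(0,T;L^∞)`.
* [RobinsonRodrigoSadowskiCUP2016] Lemma 8.15, (8.6)–(8.7).
-/

noncomputable section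

open MeasureTheory Set Filter Topology Function Real intervalIntegral Finset UnitAddTorus
open scoped InnerProductSpace RealInnerProductSpace ENNReal BigOperators

namespace Summit.NavierStokesRegularity.FunctionalMining

open Literature.Analysis Literature.Analysis.FunctionSpaces Literature.Analysis.FluidPDE
open Literature.Analysis.FunctionSpaces.Torus Literature.Analysis.FluidPDE.Torus

namespace HsChessboard

variable {d : Type*} [Fintype d] [DecidableEq d]

/-! ## 1. `t ↦ ‖ |∇ⁿu(t)|² ‖_∞` is continuous -/

/-- `|∇ⁿu|²(t, x) = ∑_w ‖∂^w u(t, x)‖²` is jointly smooth on `[a, b] × T^d` along a classical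
solution (each `∂^w u` is, `Torus.isSmoothSpaceTimeOn_wordDeriv`, and `‖·‖² = ⟪·, ·⟫`). [folklore] -/
theorem isSmoothSpaceTimeOn_wordSq {ν a b : ℝ} (hab : a < b)
    {f u : ℝ → UnitAddTorus d → EuclideanSpace ℝ d} {p : ℝ → UnitAddTorus d → ℝ}
    (h : IsClassicalNSSolutionOn (Icc a b) ν f u p) (n : ℕ) :
    Torus.IsSmoothSpaceTimeOn (Icc a b)
      (fun t x => ∑ w : Fin n → d, ‖wordDeriv (List.ofFn w) (u t) x‖ ^ 2) := by
  have hU : UniqueDiffOn ℝ (Icc a b) := uniqueDiffOn_Icc hab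
  have hw : ∀ w : Fin n → d,
      Torus.IsSmoothSpaceTimeOn (Icc a b) (fun t => wordDeriv (List.ofFn w) (u t)) := fun w =>
    Torus.isSmoothSpaceTimeOn_wordDeriv h.smooth_velocity hU (List.ofFn w)
  have e : (fun t x => ∑ w : Fin n → d, ‖wordDeriv (List.ofFn w) (u t) x‖ ^ 2) =
      fun t x => ∑ w ∈ (Finset.univ : Finset (Fin n → d)),
        ⟪wordDeriv (List.ofFn w) (u t) x, wordDeriv (List.ofFn w) (u t) x⟫_ℝ := by
    funext t x
    exact Finset.sum_congr rfl fun w _ => (real_inner_self_eq_norm_sq _).symm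
  rw [e]
  exact Torus.IsSmoothSpaceTimeOn.sum fun w _ => (hw w).inner (hw w)

/-- Along a classical solution on `[a, b] × T^d`, `t ↦ ‖ |∇ⁿu(t)|² ‖_{L^∞}` is continuous on
`[a, b]` (tube lemma over the compact torus). [folklore] -/
theorem continuousOn_supWordSq {ν a b : ℝ} (hab : a < b)
    {f u : ℝ → UnitAddTorus d → EuclideanSpace ℝ d} {p : ℝ → UnitAddTorus d → ℝ}
    (h : IsClassicalNSSolutionOn (Icc a b) ν f u p) (n : ℕ) :
    ContinuousOn (fun t => (eSupNorm fun x =>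
      ∑ w : Fin n → d, ‖wordDeriv (List.ofFn w) (u t) x‖ ^ 2).toReal) (Icc a b) :=
  (isSmoothSpaceTimeOn_wordSq hab h n).continuousOn_toReal_eSupNorm

/-- Pointwise values lie below the sup norm: `|∇ⁿv(x)|² ≤ ‖ |∇ⁿv|² ‖_∞` for smooth `v`. [folklore] -/
theorem wordSq_le_supWordSq (n : ℕ) {v : UnitAddTorus d → EuclideanSpace ℝ d} (hv : IsSmooth v)
    (x : UnitAddTorus d) :
    ∑ w : Fin n → d, ‖wordDeriv (List.ofFn w) v x‖ ^ 2 ≤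
      (eSupNorm fun x => ∑ w : Fin n → d, ‖wordDeriv (List.ofFn w) v x‖ ^ 2).toReal := by
  have hc : Continuous fun x => ∑ w : Fin n → d, ‖wordDeriv (List.ofFn w) v x‖ ^ 2 :=
    continuous_finsetSum _ fun w _ => ((isSmooth_wordDeriv hv _).continuous.norm).pow 2
  have h1 := Torus.norm_le_toReal_eSupNorm hc x
  rwa [Real.norm_of_nonneg (Finset.sum_nonneg fun w _ => sq_nonneg _)] at h1

/-! ## 2. Agmon at every order, sup-norm form -/

/-- **`‖ |∇ⁿv|² ‖_∞ ≤ (2/π²) √E_{n+1}(v) √E_{n+2}(v)`** for smooth zero-mean `v` on `T³`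
(`HsWordEnergy.sum_norm_sq_wordDeriv_le_agmon` at every point). [cite: Ayala2014Thesis, App. A (A.3)]
(every order; ours as bookkeeping) -/
theorem supWordSq_le_agmonMajorant (n : ℕ) {v : UnitAddTorus (Fin 3) → EuclideanSpace ℝ (Fin 3)}
    (hv : IsSmooth v) (hmean : HasZeroMean v) :
    (eSupNorm fun x => ∑ w : Fin n → Fin 3, ‖wordDeriv (List.ofFn w) v x‖ ^ 2).toReal ≤
      2 / π ^ 2 * Real.sqrt (torusHsEnergy ((n : ℝ) + 1) v) *
        Real.sqrt (torusHsEnergy ((n : ℝ) + 2) v) := by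
  have hB : 0 ≤ 2 / π ^ 2 * Real.sqrt (torusHsEnergy ((n : ℝ) + 1) v) *
      Real.sqrt (torusHsEnergy ((n : ℝ) + 2) v) := by positivity
  refine ENNReal.toReal_le_of_le_ofReal hB (iSup_le fun x => ?_)
  rw [← ofReal_norm, Real.norm_of_nonneg (Finset.sum_nonneg fun w _ => sq_nonneg _)]
  exact ENNReal.ofReal_le_ofReal
    (HsWordEnergy.sum_norm_sq_wordDeriv_le_agmon (d := Fin 3) (by simp) n hv hmean x)

/-! ## 3. The row `m = ∞`: `∫₀ᵀ ‖∇ⁿu‖_∞^{1/(n+1)} dt ≤ K(1+T)` -/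

/-- **Row `m = ∞` of Gibbon's chessboard on `T³`, every `n ≥ 0`, sup-norm form**
(`α_{n,∞} = 1/(n+1)`, `‖∇ⁿu‖_∞^{α_{n,∞}} = ‖ |∇ⁿu|² ‖_∞^{1/(2(n+1))}`): for `ν > 0`, `M ≥ 0` there
is `K = K(n, ν, M) ≥ 0` such that along every classical zero-mean solution of unforced
Navier–Stokes on `[0, T] × T³`, `T > 0`, with `‖u(0)‖₂² ≤ M`,
`∫₀ᵀ ‖ ∑_w ‖∂^w u(t)‖² ‖_{L^∞}^{1/(2(n+1))} dt ≤ K(1+T)` (the integrand is continuous on `[0, T]`,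
`continuousOn_supWordSq`; from `chessboard_top` and `supWordSq_le_agmonMajorant`). `n = 0` is
`u ∈ L¹(0,T;L^∞)` (explicit constants: `Literature.Analysis.FluidPDE.integral_toReal_eSupNorm_le`).
[cite: Gibbon2019Chessboard, Thm 2 (i)–(ii) eq. (w1), m = ∞; cf. Thm 1 (i)–(ii) / Table 1 (row m = ∞)]
[cite: FoiasGuillopeTemam1981, Thm 3.1] [cite: RobinsonRodrigoSadowskiCUP2016, Lemma 8.15 (8.7)]
(classical solutions, every order; ours) -/
theorem chessboard_sup (n : ℕ) {ν M : ℝ} (hν : 0 < ν) (hM : 0 ≤ M) :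
    ∃ K : ℝ, 0 ≤ K ∧ ∀ {T : ℝ}, 0 < T →
      ∀ {u : ℝ → UnitAddTorus (Fin 3) → EuclideanSpace ℝ (Fin 3)} {p : ℝ → UnitAddTorus (Fin 3) → ℝ},
      IsClassicalNSSolutionOn (Icc 0 T) ν 0 u p → (∀ t ∈ Icc 0 T, HasZeroMean (u t)) →
        ∫ x, ‖u 0 x‖ ^ 2 ≤ M →
          ∫ t in (0 : ℝ)..T, (eSupNorm fun x => ∑ w : Fin n → Fin 3,
              ‖wordDeriv (List.ofFn w) (u t) x‖ ^ 2).toReal ^ (2 * ((n : ℝ) + 1))⁻¹ ≤ K * (1 + T) := by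
  obtain ⟨K, hK0, hK⟩ := chessboard_top n hν hM
  refine ⟨K, hK0, fun {T} hT u p h hmean hu0 => le_trans ?_ (hK hT h hmean hu0)⟩
  have he0 : 0 ≤ (2 * ((n : ℝ) + 1))⁻¹ := by positivity
  have hc1 := HsTimeAverages.continuousOn_hsEnergy (s := (n : ℝ) + 1) (by positivity) hT h
  have hc2 := HsTimeAverages.continuousOn_hsEnergy (s := (n : ℝ) + 2) (by positivity) hT h
  refine intervalIntegral.integral_mono_on hT.le ?_ ?_ fun t ht => ?_
  · exact ((continuousOn_supWordSq hT h n).rpow_const fun t _ => Or.inr he0).intervalIntegrable_of_Icc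
      hT.le
  · exact (((continuousOn_const.mul hc1.sqrt).mul hc2.sqrt).rpow_const
      fun t _ => Or.inr he0).intervalIntegrable_of_Icc hT.le
  · exact Real.rpow_le_rpow ENNReal.toReal_nonneg
      (supWordSq_le_agmonMajorant n (h.smooth_velocity.isSmooth_slice ht) (hmean t ht)) he0

/-- **The square `(1, ∞)`**: `∫₀ᵀ ‖ |∇u(t)|² ‖_{L^∞}^{1/4} dt ≤ K(1+T)`, `|∇u|² = ∑ᵢ ‖∂ᵢu‖²`, i.e.
`∫₀ᵀ ‖∇u‖_∞^{1/2} dt ≤ K(1+T)` — the Navier–Stokes weak-solution counterpart, with half the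
exponent, of the Beale–Kato–Majda-level quantity `∫₀ᵀ ‖∇u‖_∞ dt` of Gibbon's Table 1
(`chessboard_sup 1`, words of length one are the partial derivatives).
[cite: Gibbon2019Chessboard, Thm 2 (i) eq. (w1) (n = 1, m = ∞); cf. Thm 1 (i) / Table 1, and (s4)]
(classical solutions; ours) -/
theorem chessboard_sup_one {ν M : ℝ} (hν : 0 < ν) (hM : 0 ≤ M) :
    ∃ K : ℝ, 0 ≤ K ∧ ∀ {T : ℝ}, 0 < T →
      ∀ {u : ℝ → UnitAddTorus (Fin 3) → EuclideanSpace ℝ (Fin 3)} {p : ℝ → UnitAddTorus (Fin 3) → ℝ},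
      IsClassicalNSSolutionOn (Icc 0 T) ν 0 u p → (∀ t ∈ Icc 0 T, HasZeroMean (u t)) →
        ∫ x, ‖u 0 x‖ ^ 2 ≤ M →
          ∫ t in (0 : ℝ)..T, (eSupNorm fun x => ∑ i : Fin 3,
              ‖Torus.partialDeriv i (u t) x‖ ^ 2).toReal ^ (1 / 4 : ℝ) ≤ K * (1 + T) := by
  obtain ⟨K, hK0, hK⟩ := chessboard_sup 1 hν hM
  refine ⟨K, hK0, fun {T} hT u p h hmean hu0 => ?_⟩
  have e : ∀ t, (fun x => ∑ i : Fin 3, ‖Torus.partialDeriv i (u t) x‖ ^ 2) =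
      fun x => ∑ w : Fin 1 → Fin 3, ‖wordDeriv (List.ofFn w) (u t) x‖ ^ 2 := by
    intro t; funext x
    rw [← (Equiv.funUnique (Fin 1) (Fin 3)).symm.sum_comp]
    refine Finset.sum_congr rfl fun i _ => ?_
    simp [List.ofFn_succ]
  have h14 : (1 / 4 : ℝ) = (2 * (((1 : ℕ) : ℝ) + 1))⁻¹ := by norm_num
  simp_rw [e, h14]
  exact hK hT h hmean hu0

end HsChessboard

end Summit.NavierStokesRegularity.FunctionalMining
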